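import Literature.Computability.QuantumComplexity.ZXCalculusTriangleNotCycle
import HarnessLib

/-!
# ZX-calculus: the transistor of Jeandel–Perdrix–Vilmart's normal forms

The **transistor** (control-separation gadget) `τ : 2 → 1` on `(control, target)`:
`τ := √2 ⊗ ((X^{(1,2)} ⊗ 𝕀) ⨾ (T ⊗ (Z^{(2,1)} ⨾ Tᵗ)) ⨾ Z^{(2,1)})`, `⟦τ⟧(|0⟩ ⊗ v) = v`, `⟦τ⟧(|1⟩ ⊗ v) = ⟨0|v⟩ (|0⟩+|1⟩)`,
and the first lemmas of its algebra that do not need `triangle-through-W`.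
[cite: JeandelPerdrixVilmart2019, §3 “The Transistor and its Algebra”, Definition (control-separation); JeandelPerdrixVilmart2018, Appendix Lemma 29]
-/

namespace Literature.Computability.QuantumComplexity

open ZXDiagram

namespace ZXDiagram

/-- **The transistor** `τ : 2 → 1` (inputs: control, target): a red copy of the control, one copy merged into the
target, the other through a triangle into the final merge, with an upside-down triangle on the target in between;
normalised by `√2` as printed. [cite: JeandelPerdrixVilmart2019, §3, Definition of the transistor (fig. `control-separation`)] -/
def transistor : ZXDiagram 2 1 :=
  dumbbell 0 0 ⊗ ((X 1 2 0 ⊗ wires 1) ⨾ (triangle ⊗ (Z 2 1 0 ⨾ triangle.transpose)) ⨾ Z 2 1 0)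

end ZXDiagram

namespace ZXClass

/-- The transistor's class, unfolded. [cite: JeandelPerdrixVilmart2019, §3, Definition of the transistor] -/
theorem mk_transistor : mk transistor =
    mk (dumbbell 0 0) ⊠ ((mk (X 1 2 0) ⊠ mk (wires 1)) ⨟ (mk triangle ⊠ (mk (Z 2 1 0) ⨟ (mk triangle).transpose)) ⨟ mk (Z 2 1 0)) := by
  simp only [transistor, mk_seq, mk_par, transpose_mk]

/-- The red copy with a triangle on one branch, merged: `X^{(1,2)} ⨾ (T ⊗ 𝕀) ⨾ Z^{(2,1)} = 1/√2 ⊗ (X(π) ⨾ T)`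
(the looped triangle, transposed). [cite: JeandelPerdrixVilmart2018, Appendix Lemmas 21, 29] -/
theorem xsplit_seq_triangle_par_seq_merge : mk (X 1 2 0) ⨟ (mk triangle ⊠ mk (wires 1)) ⨟ mk (Z 2 1 0) = mk invSqrtTwo ⊠ (mk (X 1 1 4) ⨟ mk triangle) := by
  have h := congrArg transpose triangleT_seq_X_pi_eq_loop
  rw [transpose_seq, transpose_transpose, transpose_mk (X 1 1 4), ZXDiagram.transpose_X, transpose_par, transpose_mk (dumbbell 0 0), mk_transpose_dumbbell,
    transpose_seq, transpose_seq, transpose_par, transpose_transpose, transpose_mk (Z 1 2 0), transpose_mk (X 2 1 0), transpose_mk (wires 1),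
    ZXDiagram.transpose_Z, ZXDiagram.transpose_X, ZXDiagram.transpose_wires, ← seq_assoc] at h
  rw [← invSqrtTwo_par_sqrt_two_par_one (mk (X 1 2 0) ⨟ (mk triangle ⊠ mk (wires 1)) ⨟ mk (Z 2 1 0)), ← h]

/-- The red copy with three outputs is symmetric in its last two. [cite: JeandelPerdrixVilmart2018, §2.2] -/
theorem X_one_three_seq_par_swap : mk (X 1 3 0) ⨟ (mk (wires 1) ⊠ mk swap) = mk (X 1 3 0) := by
  have h := congrArg colorSwap Z_one_three_seq_par_swap
  simpa using h

/-- `X^{(1,2)} ⨾ (X^{(1,2)} ⊗ 𝕀) = X^{(1,3)}`. [cite: JeandelPerdrixVilmart2018, Fig. 1 (S1)] -/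
theorem xsplit_seq_xsplit_par : mk (X 1 2 0) ⨟ (mk (X 1 2 0) ⊠ mk (wires 1)) = mk (X 1 3 0) := by
  have h := congrArg colorSwap (Z_seq_Z_par 1 1 1 2 le_rfl 0 0)
  simpa using h

/-- **The W-merge is symmetric** (the transposes of the fork and of its mirror image agree):
`(𝕀 ⊗ X^{(1,2)}) ⨾ ((Z^{(2,1)} ⨾ Tᵗ) ⊗ 𝕀) ⨾ Z^{(2,1)} = (X^{(1,2)} ⊗ 𝕀) ⨾ (𝕀 ⊗ (Z^{(2,1)} ⨾ Tᵗ)) ⨾ Z^{(2,1)}`.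
[cite: JeandelPerdrixVilmart2018, Appendix Lemma 30 (black dot: swappable outputs), transposed] -/
theorem wMerge_symm : (mk (wires 1) ⊠ mk (X 1 2 0)) ⨟ ((mk (Z 2 1 0) ⨟ (mk triangle).transpose) ⊠ mk (wires 1)) ⨟ mk (Z 2 1 0) = (mk (X 1 2 0) ⊠ mk (wires 1)) ⨟ (mk (wires 1) ⊠ (mk (Z 2 1 0) ⨟ (mk triangle).transpose)) ⨟ mk (Z 2 1 0) := by
  have h := congrArg transpose fork_eq_mirror
  rw [transpose_seq, transpose_seq, transpose_par, transpose_par, transpose_seq, transpose_mk (Z 1 2 0), transpose_mk (wires 1), transpose_mk (X 2 1 0),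
    ZXDiagram.transpose_Z, ZXDiagram.transpose_wires, ZXDiagram.transpose_X,
    transpose_seq, transpose_seq, transpose_par, transpose_par, transpose_seq, transpose_mk (Z 1 2 0), transpose_mk (wires 1), transpose_mk (X 2 1 0),
    ZXDiagram.transpose_Z, ZXDiagram.transpose_wires, ZXDiagram.transpose_X, ← seq_assoc, ← seq_assoc] at h
  exact h.symm

/-- The common core of the transistor lemmas: a red copy with a triangle leg, a plain leg and a leg merged with the
target under `Tᵗ`, all merged, is `1/√2 ⊗ ((X^{(1,2)}(π) ⊗ 𝕀) ⨾ (T ⊗ (Z^{(2,1)} ⨾ Tᵗ)) ⨾ Z^{(2,1)})`.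
[cite: JeandelPerdrixVilmart2018, Appendix Lemmas 21, 29] -/
theorem xsplit3_triangle_plain_merge_core :
    (mk (X 1 3 0) ⊠ mk (wires 1)) ⨟ (mk triangle ⊠ (mk (wires 1) ⊠ (mk (Z 2 1 0) ⨟ (mk triangle).transpose))) ⨟ mk (Z 3 1 0) = mk invSqrtTwo ⊠ ((mk (X 1 2 4) ⊠ mk (wires 1)) ⨟ (mk triangle ⊠ (mk (Z 2 1 0) ⨟ (mk triangle).transpose)) ⨟ mk (Z 2 1 0)) := by
  have hZ31 : mk (Z 3 1 0) = (mk (Z 2 1 0) ⊠ mk (wires 1)) ⨟ mk (Z 2 1 0) := by rw [Z_par_seq_Z 2 1 1 1 le_rfl, add_zero]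
  rw [← xsplit_seq_xsplit_par, seq_par_wires, hZ31, ← seq_assoc _ (mk (Z 2 1 0) ⊠ mk (wires 1)) (mk (Z 2 1 0)), seq_assoc (mk (X 1 2 0) ⊠ mk (wires 1)) ((mk (X 1 2 0) ⊠ mk (wires 1)) ⊠ mk (wires 1)),
    seq_assoc (mk (X 1 2 0) ⊠ mk (wires 1)) _ (mk (Z 2 1 0) ⊠ mk (wires 1)),
    show (((mk (X 1 2 0) ⊠ mk (wires 1)) ⊠ mk (wires 1)) ⨟ (mk triangle ⊠ (mk (wires 1) ⊠ (mk (Z 2 1 0) ⨟ (mk triangle).transpose)))) ⨟ (mk (Z 2 1 0) ⊠ mk (wires 1)) = (mk (X 1 2 0) ⨟ (mk triangle ⊠ mk (wires 1)) ⨟ mk (Z 2 1 0)) ⊠ (mk (Z 2 1 0) ⨟ (mk triangle).transpose) from by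
      rw [show (mk (X 1 2 0) ⊠ mk (wires 1)) ⊠ mk (wires 1) = mk (X 1 2 0) ⊠ (mk (wires 1) ⊠ mk (wires 1)) from (par_assoc _ _ _).trans (cast_id _ _ _), wires_par_wires,
        show mk triangle ⊠ (mk (wires 1) ⊠ (mk (Z 2 1 0) ⨟ (mk triangle).transpose)) = (mk triangle ⊠ mk (wires 1)) ⊠ (mk (Z 2 1 0) ⨟ (mk triangle).transpose) from (par_assoc' _ _ _).trans (cast_id _ _ _), interchange, id_seq, interchange, seq_id],
    xsplit_seq_triangle_par_seq_merge, show ∀ (s : ZXClass 0 0) (A : ZXClass 1 1) (B : ZXClass 2 1), (s ⊠ A) ⊠ B = s ⊠ (A ⊠ B) from fun s A B => (par_assoc _ _ _).trans (cast_id _ _ _),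
    show ∀ (A : ZXClass 2 3) (s : ZXClass 0 0) (B : ZXClass 3 2), A ⨟ (s ⊠ B) = s ⊠ (A ⨟ B) from fun A s B => by rw [scalar_par_seq_right, empty_par, cast_id],
    show ∀ (s : ZXClass 0 0) (A : ZXClass 2 2) (B : ZXClass 2 1), (s ⊠ A) ⨟ B = s ⊠ (A ⨟ B) from fun s A B => by rw [scalar_par_seq_left, empty_par, cast_id],
    show (mk (X 1 1 4) ⨟ mk triangle) ⊠ (mk (Z 2 1 0) ⨟ (mk triangle).transpose) = (mk (X 1 1 4) ⊠ mk (wires 2)) ⨟ (mk triangle ⊠ (mk (Z 2 1 0) ⨟ (mk triangle).transpose)) from by rw [eq_comm, interchange, id_seq],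
    ← seq_assoc (mk (X 1 2 0) ⊠ mk (wires 1)), show (mk (X 1 2 0) ⊠ mk (wires 1)) ⨟ (mk (X 1 1 4) ⊠ mk (wires 2)) = mk (X 1 2 4) ⊠ mk (wires 1) from by
      rw [← wires_par_wires 1 1, show mk (X 1 1 4) ⊠ (mk (wires 1) ⊠ mk (wires 1)) = (mk (X 1 1 4) ⊠ mk (wires 1)) ⊠ mk (wires 1) from (par_assoc' _ _ _).trans (cast_id _ _ _), interchange, seq_id,
        xsplit_seq_xphase_par]]

/-- **JPV LICS 2019, Lemma `swapped-CNOT-under-controlsep`**: a swapped CNOT (red copy of the control merged into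
the transistor's output) is absorbed into a red `π` on the transistor's copy:
`√2 ⊗ ((X^{(1,2)} ⊗ 𝕀) ⨾ (𝕀 ⊗ σ) ⨾ (τ ⊗ 𝕀) ⨾ Z^{(2,1)}) = √2 ⊗ ((X^{(1,2)}(π) ⊗ 𝕀) ⨾ (T ⊗ (Z^{(2,1)} ⨾ Tᵗ)) ⨾ Z^{(2,1)})`.
[cite: JeandelPerdrixVilmart2019, Appendix (proof of `swapped-CNOT-under-controlsep`); JeandelPerdrixVilmart2018, Appendix Lemma 29] -/
theorem swappedCNOT_under_transistor :
    mk (dumbbell 0 0) ⊠ ((mk (X 1 2 0) ⊠ mk (wires 1)) ⨟ (mk (wires 1) ⊠ mk swap) ⨟ (mk transistor ⊠ mk (wires 1)) ⨟ mk (Z 2 1 0)) =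
      mk (dumbbell 0 0) ⊠ ((mk (X 1 2 4) ⊠ mk (wires 1)) ⨟ (mk triangle ⊠ (mk (Z 2 1 0) ⨟ (mk triangle).transpose)) ⨟ mk (Z 2 1 0)) := by
  -- fuse the two red copies
  have hXfuse : (mk (X 1 2 0) ⊠ mk (wires 1)) ⨟ (mk (wires 1) ⊠ mk swap) ⨟ ((mk (X 1 2 0) ⊠ mk (wires 1)) ⊠ mk (wires 1)) = (mk (X 1 3 0) ⊠ mk (wires 1)) ⨟ (mk (wires 2) ⊠ mk swap) := by
    rw [seq_assoc, show (mk (wires 1) ⊠ mk swap) ⨟ ((mk (X 1 2 0) ⊠ mk (wires 1)) ⊠ mk (wires 1)) = ((mk (X 1 2 0) ⊠ mk (wires 1)) ⊠ mk (wires 1)) ⨟ (mk (wires 2) ⊠ mk swap) from by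
        rw [show (mk (X 1 2 0) ⊠ mk (wires 1)) ⊠ mk (wires 1) = mk (X 1 2 0) ⊠ mk (wires 2) from by rw [← wires_par_wires 1 1]; exact (par_assoc _ _ _).trans (cast_id _ _ _),
          interchange, interchange, id_seq, seq_id, id_seq, seq_id],
      ← seq_assoc, interchange, xsplit_seq_xsplit_par, seq_id]
  have hτ : ((mk (X 1 2 0) ⊠ mk (wires 1)) ⨟ (mk triangle ⊠ (mk (Z 2 1 0) ⨟ (mk triangle).transpose)) ⨟ mk (Z 2 1 0)) ⊠ mk (wires 1) = ((mk (X 1 2 0) ⊠ mk (wires 1)) ⊠ mk (wires 1)) ⨟ ((mk triangle ⊠ (mk (Z 2 1 0) ⨟ (mk triangle).transpose)) ⊠ mk (wires 1)) ⨟ (mk (Z 2 1 0) ⊠ mk (wires 1)) := by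
    rw [seq_par_wires, seq_par_wires]
  -- the final merge is symmetric: bring the plain copy next to the triangle copy
  have hZ31 : mk (Z 3 1 0) = (mk (Z 2 1 0) ⊠ mk (wires 1)) ⨟ mk (Z 2 1 0) := by rw [Z_par_seq_Z 2 1 1 1 le_rfl, add_zero]
  have hZsw : (mk (wires 1) ⊠ mk swap) ⨟ mk (Z 3 1 0) = mk (Z 3 1 0) := by
    rw [show mk (Z 3 1 0) = (mk (wires 1) ⊠ mk (Z 2 1 0)) ⨟ mk (Z 2 1 0) from by rw [par_Z_seq_Z 1 2 1 1 le_rfl, add_zero], ← seq_assoc, ← wires_par_seq, swap_seq_Z]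
  have hQsw : ((mk (Z 2 1 0) ⨟ (mk triangle).transpose) ⊠ mk (wires 1)) ⨟ mk swap = ((mk (wires 1) ⊠ mk swap) ⨟ (mk swap ⊠ mk (wires 1))) ⨟ (mk (wires 1) ⊠ (mk (Z 2 1 0) ⨟ (mk triangle).transpose)) := by
    rw [← bswap1_two, bswap1_seq_wires_par, bswap1_one]
  have hC2 : (mk (X 1 3 0) ⊠ mk (wires 1)) ⨟ (mk (wires 2) ⊠ mk swap) ⨟ ((mk triangle ⊠ (mk (Z 2 1 0) ⨟ (mk triangle).transpose)) ⊠ mk (wires 1)) ⨟ mk (Z 3 1 0) = (mk (X 1 3 0) ⊠ mk (wires 1)) ⨟ (mk triangle ⊠ (mk (wires 1) ⊠ (mk (Z 2 1 0) ⨟ (mk triangle).transpose))) ⨟ mk (Z 3 1 0) := by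
    rw [← hZsw, ← seq_assoc _ (mk (wires 1) ⊠ mk swap) (mk (Z 3 1 0)), seq_assoc _ ((mk triangle ⊠ (mk (Z 2 1 0) ⨟ (mk triangle).transpose)) ⊠ mk (wires 1)) (mk (wires 1) ⊠ mk swap),
      show ((mk triangle ⊠ (mk (Z 2 1 0) ⨟ (mk triangle).transpose)) ⊠ mk (wires 1)) ⨟ (mk (wires 1) ⊠ mk swap) = (mk (wires 1) ⊠ ((mk (wires 1) ⊠ mk swap) ⨟ (mk swap ⊠ mk (wires 1)))) ⨟ (mk triangle ⊠ (mk (wires 1) ⊠ (mk (Z 2 1 0) ⨟ (mk triangle).transpose))) from by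
        rw [show (mk triangle ⊠ (mk (Z 2 1 0) ⨟ (mk triangle).transpose)) ⊠ mk (wires 1) = mk triangle ⊠ ((mk (Z 2 1 0) ⨟ (mk triangle).transpose) ⊠ mk (wires 1)) from (par_assoc _ _ _).trans (cast_id _ _ _), interchange, seq_id, hQsw, eq_comm, interchange, id_seq],
      ← seq_assoc _ (mk (wires 1) ⊠ ((mk (wires 1) ⊠ mk swap) ⨟ (mk swap ⊠ mk (wires 1)))), seq_assoc (mk (X 1 3 0) ⊠ mk (wires 1)) (mk (wires 2) ⊠ mk swap) (mk (wires 1) ⊠ ((mk (wires 1) ⊠ mk swap) ⨟ (mk swap ⊠ mk (wires 1)))),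
      show (mk (wires 2) ⊠ mk swap) ⨟ (mk (wires 1) ⊠ ((mk (wires 1) ⊠ mk swap) ⨟ (mk swap ⊠ mk (wires 1)))) = mk (wires 1) ⊠ (mk swap ⊠ mk (wires 1)) from by
        rw [wires_par_seq, ← seq_assoc, show mk (wires 1) ⊠ (mk (wires 1) ⊠ mk swap) = mk (wires 2) ⊠ mk swap from by rw [← wires_par_wires 1 1]; exact (par_assoc' _ _ _).trans (cast_id _ _ _),
          ← wires_par_seq, swap_seq_swap, wires_par_wires, id_seq],
      show mk (wires 1) ⊠ (mk swap ⊠ mk (wires 1)) = (mk (wires 1) ⊠ mk swap) ⊠ mk (wires 1) from (par_assoc' _ _ _).trans (cast_id _ _ _), ← seq_par_wires, X_one_three_seq_par_swap, hZsw]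
  rw [mk_transistor, show ∀ (s : ZXClass 0 0) (A : ZXClass 2 1), (s ⊠ A) ⊠ mk (wires 1) = s ⊠ (A ⊠ mk (wires 1)) from fun s A => (par_assoc _ _ _).trans (cast_id _ _ _),
    show ∀ (A : ZXClass 2 3) (s : ZXClass 0 0) (B : ZXClass 3 2), A ⨟ (s ⊠ B) = s ⊠ (A ⨟ B) from fun A s B => by rw [scalar_par_seq_right, empty_par, cast_id],
    show ∀ (s : ZXClass 0 0) (A : ZXClass 2 2) (B : ZXClass 2 1), (s ⊠ A) ⨟ B = s ⊠ (A ⨟ B) from fun s A B => by rw [scalar_par_seq_left, empty_par, cast_id],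
    hτ, seq_assoc ((mk (X 1 2 0) ⊠ mk (wires 1)) ⊠ mk (wires 1)) ((mk triangle ⊠ (mk (Z 2 1 0) ⨟ (mk triangle).transpose)) ⊠ mk (wires 1)) (mk (Z 2 1 0) ⊠ mk (wires 1)), ← seq_assoc _ ((mk (X 1 2 0) ⊠ mk (wires 1)) ⊠ mk (wires 1)) _, hXfuse,
    seq_assoc _ _ (mk (Z 2 1 0)), seq_assoc ((mk triangle ⊠ (mk (Z 2 1 0) ⨟ (mk triangle).transpose)) ⊠ mk (wires 1)) (mk (Z 2 1 0) ⊠ mk (wires 1)) (mk (Z 2 1 0)), ← hZ31, ← seq_assoc _ ((mk triangle ⊠ (mk (Z 2 1 0) ⨟ (mk triangle).transpose)) ⊠ mk (wires 1)) (mk (Z 3 1 0)),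
    hC2, xsplit3_triangle_plain_merge_core, sqrt_two_par_invSqrtTwo_par_two_one]
  where
  sqrt_two_par_invSqrtTwo_par_two_one (A : ZXClass 2 1) : mk (dumbbell 0 0) ⊠ (mk invSqrtTwo ⊠ A) = A := by
    rw [scalar_par_scalar_par, invSqrtTwo_par_sqrt_two_par_two_one]

/-- **JPV LICS 2019, Lemma `anti-controlsep`**: copying the target around the transistor (red copy above,
green merge below) gives the anti-transistor:
`√2 ⊗ ((𝕀 ⊗ X^{(1,2)}) ⨾ (τ ⊗ 𝕀) ⨾ Z^{(2,1)}) = √2 ⊗ ((X^{(1,2)}(π) ⊗ 𝕀) ⨾ (T ⊗ (Z^{(2,1)} ⨾ Tᵗ)) ⨾ Z^{(2,1)})`.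
[cite: JeandelPerdrixVilmart2019, Appendix (proof of `anti-controlsep`); JeandelPerdrixVilmart2018, Appendix Lemmas 29, 30] -/
theorem target_copied_around_transistor :
    mk (dumbbell 0 0) ⊠ ((mk (wires 1) ⊠ mk (X 1 2 0)) ⨟ (mk transistor ⊠ mk (wires 1)) ⨟ mk (Z 2 1 0)) =
      mk (dumbbell 0 0) ⊠ ((mk (X 1 2 4) ⊠ mk (wires 1)) ⨟ (mk triangle ⊠ (mk (Z 2 1 0) ⨟ (mk triangle).transpose)) ⨟ mk (Z 2 1 0)) := by
  have hτ : ((mk (X 1 2 0) ⊠ mk (wires 1)) ⨟ (mk triangle ⊠ (mk (Z 2 1 0) ⨟ (mk triangle).transpose)) ⨟ mk (Z 2 1 0)) ⊠ mk (wires 1) = ((mk (X 1 2 0) ⊠ mk (wires 1)) ⊠ mk (wires 1)) ⨟ ((mk triangle ⊠ (mk (Z 2 1 0) ⨟ (mk triangle).transpose)) ⊠ mk (wires 1)) ⨟ (mk (Z 2 1 0) ⊠ mk (wires 1)) := by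
    rw [seq_par_wires, seq_par_wires]
  have hZ31 : mk (Z 3 1 0) = (mk (Z 2 1 0) ⊠ mk (wires 1)) ⨟ mk (Z 2 1 0) := by rw [Z_par_seq_Z 2 1 1 1 le_rfl, add_zero]
  have hZ31' : mk (Z 3 1 0) = (mk (wires 1) ⊠ mk (Z 2 1 0)) ⨟ mk (Z 2 1 0) := by rw [par_Z_seq_Z 1 2 1 1 le_rfl, add_zero]
  -- the copy of the target feeds the W-merge `G`; by its symmetry it becomes a copy of the control
  have hK : (mk (wires 1) ⊠ mk (X 1 2 0)) ⨟ (((mk (X 1 2 0) ⊠ mk (wires 1)) ⨟ (mk triangle ⊠ (mk (Z 2 1 0) ⨟ (mk triangle).transpose)) ⨟ mk (Z 2 1 0)) ⊠ mk (wires 1)) ⨟ mk (Z 2 1 0) = (mk (X 1 3 0) ⊠ mk (wires 1)) ⨟ (mk triangle ⊠ (mk (wires 1) ⊠ (mk (Z 2 1 0) ⨟ (mk triangle).transpose))) ⨟ mk (Z 3 1 0) := by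
    rw [hτ, seq_assoc _ (((mk triangle ⊠ (mk (Z 2 1 0) ⨟ (mk triangle).transpose)) ⊠ mk (wires 1))) (mk (Z 2 1 0) ⊠ mk (wires 1)), ← seq_assoc (mk (wires 1) ⊠ mk (X 1 2 0)),
      show (mk (wires 1) ⊠ mk (X 1 2 0)) ⨟ ((mk (X 1 2 0) ⊠ mk (wires 1)) ⊠ mk (wires 1)) = mk (X 1 2 0) ⊠ mk (X 1 2 0) from by
        rw [show (mk (X 1 2 0) ⊠ mk (wires 1)) ⊠ mk (wires 1) = mk (X 1 2 0) ⊠ (mk (wires 1) ⊠ mk (wires 1)) from (par_assoc _ _ _).trans (cast_id _ _ _), wires_par_wires, interchange, id_seq, seq_id],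
      seq_assoc, seq_assoc, ← hZ31, hZ31',
      show (mk triangle ⊠ (mk (Z 2 1 0) ⨟ (mk triangle).transpose)) ⊠ mk (wires 1) = mk triangle ⊠ ((mk (Z 2 1 0) ⨟ (mk triangle).transpose) ⊠ mk (wires 1)) from (par_assoc _ _ _).trans (cast_id _ _ _), ← seq_assoc (mk triangle ⊠ ((mk (Z 2 1 0) ⨟ (mk triangle).transpose) ⊠ mk (wires 1))),
      show (mk triangle ⊠ ((mk (Z 2 1 0) ⨟ (mk triangle).transpose) ⊠ mk (wires 1))) ⨟ (mk (wires 1) ⊠ mk (Z 2 1 0)) = mk triangle ⊠ (((mk (Z 2 1 0) ⨟ (mk triangle).transpose) ⊠ mk (wires 1)) ⨟ mk (Z 2 1 0)) from by rw [interchange, seq_id],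
      show mk (X 1 2 0) ⊠ mk (X 1 2 0) = (mk (X 1 2 0) ⊠ mk (wires 1)) ⨟ (mk (wires 1) ⊠ (mk (wires 1) ⊠ mk (X 1 2 0))) from by
        rw [par_eq_seq_left (mk (X 1 2 0)) (mk (X 1 2 0)), ← wires_par_wires 1 1]; exact congrArg _ ((par_assoc _ _ _).trans (cast_id _ _ _)),
      seq_assoc (mk (X 1 2 0) ⊠ mk (wires 1)), ← seq_assoc (mk (wires 1) ⊠ (mk (wires 1) ⊠ mk (X 1 2 0))),
      show (mk (wires 1) ⊠ (mk (wires 1) ⊠ mk (X 1 2 0))) ⨟ (mk triangle ⊠ (((mk (Z 2 1 0) ⨟ (mk triangle).transpose) ⊠ mk (wires 1)) ⨟ mk (Z 2 1 0))) = mk triangle ⊠ (((mk (wires 1) ⊠ mk (X 1 2 0)) ⨟ ((mk (Z 2 1 0) ⨟ (mk triangle).transpose) ⊠ mk (wires 1))) ⨟ mk (Z 2 1 0)) from by rw [interchange, id_seq, ← seq_assoc],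
      wMerge_symm, show mk triangle ⊠ (((mk (X 1 2 0) ⊠ mk (wires 1)) ⨟ (mk (wires 1) ⊠ (mk (Z 2 1 0) ⨟ (mk triangle).transpose))) ⨟ mk (Z 2 1 0)) = (mk (wires 1) ⊠ (mk (X 1 2 0) ⊠ mk (wires 1))) ⨟ ((mk triangle ⊠ (mk (wires 1) ⊠ (mk (Z 2 1 0) ⨟ (mk triangle).transpose))) ⨟ (mk (wires 1) ⊠ mk (Z 2 1 0))) from by
        rw [eq_comm, interchange, seq_id, interchange, id_seq, ← seq_assoc],
      ← seq_assoc (mk (X 1 2 0) ⊠ mk (wires 1)), ← seq_assoc (mk (X 1 2 0) ⊠ mk (wires 1)),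
      show (mk (X 1 2 0) ⊠ mk (wires 1)) ⨟ (mk (wires 1) ⊠ (mk (X 1 2 0) ⊠ mk (wires 1))) = mk (X 1 3 0) ⊠ mk (wires 1) from by
        rw [show mk (wires 1) ⊠ (mk (X 1 2 0) ⊠ mk (wires 1)) = (mk (wires 1) ⊠ mk (X 1 2 0)) ⊠ mk (wires 1) from (par_assoc' _ _ _).trans (cast_id _ _ _), ← seq_par_wires, X_seq_par_X 1 1 1 2 le_rfl, add_zero],
      seq_assoc, seq_assoc, ← hZ31', ← seq_assoc]
  rw [mk_transistor, show ∀ (s : ZXClass 0 0) (A : ZXClass 2 1), (s ⊠ A) ⊠ mk (wires 1) = s ⊠ (A ⊠ mk (wires 1)) from fun s A => (par_assoc _ _ _).trans (cast_id _ _ _),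
    show ∀ (A : ZXClass 2 3) (s : ZXClass 0 0) (B : ZXClass 3 2), A ⨟ (s ⊠ B) = s ⊠ (A ⨟ B) from fun A s B => by rw [scalar_par_seq_right, empty_par, cast_id],
    show ∀ (s : ZXClass 0 0) (A : ZXClass 2 2) (B : ZXClass 2 1), (s ⊠ A) ⨟ B = s ⊠ (A ⨟ B) from fun s A B => by rw [scalar_par_seq_left, empty_par, cast_id],
    hK, xsplit3_triangle_plain_merge_core, scalar_par_scalar_par (mk (dumbbell 0 0)) (mk invSqrtTwo), invSqrtTwo_par_sqrt_two_par_two_one]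

/-! ### CNOT tools -/

/-- `NOTC ⨾ NOTC = 1/2 ⊗ 𝕀₂` (the red copy doubly linked to the green merge: Hopf). [cite: JeandelPerdrixVilmart2018, Fig. 1 (IV), (B1)] -/
theorem notc_seq_notc : ((mk (X 1 2 0) ⊠ mk (wires 1)) ⨟ (mk (wires 1) ⊠ mk (Z 2 1 0))) ⨟ ((mk (X 1 2 0) ⊠ mk (wires 1)) ⨟ (mk (wires 1) ⊠ mk (Z 2 1 0))) = mk invSqrtTwo ⊠ (mk invSqrtTwo ⊠ mk (wires 2)) := by
  have hmid : (mk (wires 1) ⊠ mk (Z 2 1 0)) ⨟ (mk (X 1 2 0) ⊠ mk (wires 1)) = (mk (X 1 2 0) ⊠ mk (wires 2)) ⨟ (mk (wires 2) ⊠ mk (Z 2 1 0)) := by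
    rw [interchange, interchange, id_seq, seq_id, seq_id, id_seq]
  have hX : (mk (X 1 2 0) ⊠ mk (wires 1)) ⨟ (mk (X 1 2 0) ⊠ mk (wires 2)) = (mk (X 1 2 0) ⊠ mk (wires 1)) ⨟ ((mk (wires 1) ⊠ mk (X 1 2 0)) ⊠ mk (wires 1)) := by
    rw [← wires_par_wires 1 1, show mk (X 1 2 0) ⊠ (mk (wires 1) ⊠ mk (wires 1)) = (mk (X 1 2 0) ⊠ mk (wires 1)) ⊠ mk (wires 1) from (par_assoc' _ _ _).trans (cast_id _ _ _),
      ← seq_par_wires, ← seq_par_wires, xsplit_seq_xsplit_par, show mk (X 1 3 0) = mk (X 1 2 0) ⨟ (mk (wires 1) ⊠ mk (X 1 2 0)) from by rw [X_seq_par_X 1 1 1 2 le_rfl, add_zero]]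
  have hZ : (mk (wires 2) ⊠ mk (Z 2 1 0)) ⨟ (mk (wires 1) ⊠ mk (Z 2 1 0)) = (mk (wires 1) ⊠ (mk (Z 2 1 0) ⊠ mk (wires 1))) ⨟ (mk (wires 1) ⊠ mk (Z 2 1 0)) := by
    rw [show mk (wires 2) ⊠ mk (Z 2 1 0) = mk (wires 1) ⊠ (mk (wires 1) ⊠ mk (Z 2 1 0)) from by rw [← wires_par_wires 1 1]; exact (par_assoc _ _ _).trans (cast_id _ _ _),
      ← wires_par_seq, ← wires_par_seq, par_Z_seq_Z 1 2 1 1 le_rfl, add_zero,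
      show mk (wires 1) ⊠ mk (Z (1 + 2) 1 0) = mk (wires 1) ⊠ ((mk (Z 2 1 0) ⊠ mk (wires 1)) ⨟ mk (Z 2 1 0)) from by rw [Z_par_seq_Z 2 1 1 1 le_rfl, add_zero]]
  have hkill1 : (mk (X 1 2 0) ⊠ mk (wires 1)) ⨟ (mk (wires 1) ⊠ (mk (X 1 0 0) ⊠ mk (wires 1))) = mk (wires 2) := by
    rw [show mk (wires 1) ⊠ (mk (X 1 0 0) ⊠ mk (wires 1)) = (mk (wires 1) ⊠ mk (X 1 0 0)) ⊠ mk (wires 1) from (par_assoc' _ _ _).trans (cast_id _ _ _), ← seq_par_wires, X_seq_par_X 1 1 1 0 le_rfl, add_zero (0 : ZMod 8),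
      show mk (X 1 (1 + 0) 0) = mk (wires 1) from X_one_one, wires_par_wires]
  have hkill2 : (mk (wires 1) ⊠ (mk (Z 0 1 0) ⊠ mk (wires 1))) ⨟ (mk (wires 1) ⊠ mk (Z 2 1 0)) = mk (wires 2) := by
    rw [← wires_par_seq, Z_par_seq_Z 0 1 1 1 le_rfl, add_zero, Z_one_one, wires_par_wires]
  have hsc1 : ∀ (s : ZXClass 0 0) (A : ZXClass 1 1), (s ⊠ A) ⊠ mk (wires 1) = s ⊠ (A ⊠ mk (wires 1)) := fun s A => (par_assoc _ _ _).trans (cast_id _ _ _)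
  have hsc2 : ∀ (s : ZXClass 0 0) (A : ZXClass 2 2), mk (wires 1) ⊠ (s ⊠ A) = s ⊠ (mk (wires 1) ⊠ A) := fun s A => by
    rw [show mk (wires 1) ⊠ (s ⊠ A) = (mk (wires 1) ⊠ s) ⊠ A from (par_assoc' _ _ _).trans (cast_id _ _ _), ← scalar_par_wires]; exact (par_assoc _ _ _).trans (cast_id _ _ _)
  have hsc5 : ∀ (s : ZXClass 0 0) (A : ZXClass 3 3) (B : ZXClass 3 2), (s ⊠ A) ⨟ B = s ⊠ (A ⨟ B) := fun s A B => by rw [scalar_par_seq_left, empty_par, cast_id]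
  have hsc6 : ∀ (A : ZXClass 2 3) (s : ZXClass 0 0) (B : ZXClass 3 2), A ⨟ (s ⊠ B) = s ⊠ (A ⨟ B) := fun A s B => by rw [scalar_par_seq_right, empty_par, cast_id]
  rw [seq_assoc, ← seq_assoc (mk (wires 1) ⊠ mk (Z 2 1 0)) (mk (X 1 2 0) ⊠ mk (wires 1)), hmid, seq_assoc (mk (X 1 2 0) ⊠ mk (wires 2)), ← seq_assoc (mk (X 1 2 0) ⊠ mk (wires 1)) (mk (X 1 2 0) ⊠ mk (wires 2)),
    hX, hZ, seq_assoc, ← seq_assoc ((mk (wires 1) ⊠ mk (X 1 2 0)) ⊠ mk (wires 1)),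
    show ((mk (wires 1) ⊠ mk (X 1 2 0)) ⊠ mk (wires 1)) ⨟ (mk (wires 1) ⊠ (mk (Z 2 1 0) ⊠ mk (wires 1))) = mk (wires 1) ⊠ ((mk (X 1 2 0) ⨟ mk (Z 2 1 0)) ⊠ mk (wires 1)) from by
      rw [show (mk (wires 1) ⊠ mk (X 1 2 0)) ⊠ mk (wires 1) = mk (wires 1) ⊠ (mk (X 1 2 0) ⊠ mk (wires 1)) from (par_assoc _ _ _).trans (cast_id _ _ _), ← wires_par_seq, ← seq_par_wires],
    xsplit_seq_merge_eq]
  rw [hsc1, hsc1, hsc2, hsc2, hsc5, hsc5, hsc6, hsc6, seq_par_wires, wires_par_seq, seq_assoc, ← seq_assoc (mk (X 1 2 0) ⊠ mk (wires 1)), hkill1, id_seq, hkill2]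

/-- `CNOT ⨾ NOTC = 1/√2 ⊗ (NOTC ⨾ σ)` (bialgebra). [cite: JeandelPerdrixVilmart2018, Fig. 1 (B2)] -/
theorem cnot_seq_notc : ((mk (Z 1 2 0) ⊠ mk (wires 1)) ⨟ (mk (wires 1) ⊠ mk (X 2 1 0))) ⨟ ((mk (X 1 2 0) ⊠ mk (wires 1)) ⨟ (mk (wires 1) ⊠ mk (Z 2 1 0))) = mk invSqrtTwo ⊠ (((mk (X 1 2 0) ⊠ mk (wires 1)) ⨟ (mk (wires 1) ⊠ mk (Z 2 1 0))) ⨟ mk swap) := by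
  rw [rule_B2_cnot, show ∀ (s : ZXClass 0 0) (A B : ZXClass 2 2), (s ⊠ A) ⨟ B = s ⊠ (A ⨟ B) from fun s A B => by rw [scalar_par_seq_left, empty_par, cast_id],
    seq_assoc _ ((mk (X 1 2 0) ⊠ mk (wires 1)) ⨟ (mk (wires 1) ⊠ mk (Z 2 1 0))) ((mk (X 1 2 0) ⊠ mk (wires 1)) ⨟ (mk (wires 1) ⊠ mk (Z 2 1 0))), notc_seq_notc, show ∀ (A : ZXClass 2 2) (s : ZXClass 0 0) (B : ZXClass 2 2), A ⨟ (s ⊠ B) = s ⊠ (A ⨟ B) from fun A s B => by rw [scalar_par_seq_right, empty_par, cast_id],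
    show ∀ (A : ZXClass 2 2) (s : ZXClass 0 0) (B : ZXClass 2 2), A ⨟ (s ⊠ B) = s ⊠ (A ⨟ B) from fun A s B => by rw [scalar_par_seq_right, empty_par, cast_id],
    seq_id, sqrt_two_par_invSqrtTwo_par]
  where
  sqrt_two_par_invSqrtTwo_par (A : ZXClass 2 2) : mk (dumbbell 0 0) ⊠ (mk invSqrtTwo ⊠ (mk invSqrtTwo ⊠ A)) = mk invSqrtTwo ⊠ A := by
    rw [show mk (dumbbell 0 0) ⊠ (mk invSqrtTwo ⊠ (mk invSqrtTwo ⊠ A)) = (mk (dumbbell 0 0) ⊠ mk invSqrtTwo) ⊠ (mk invSqrtTwo ⊠ A) from (par_assoc' _ _ _).trans (cast_id _ _ _),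
      scalar_par_comm (mk (dumbbell 0 0)), invSqrtTwo_par_dumbbell, empty_par, cast_id]

/-- `X(π) ⨾ Tᵗ = T ⨾ X(π)`. [cite: JeandelPerdrixVilmart2018, Appendix Lemma 21] -/
theorem X_pi_seq_triangleT : mk (X 1 1 4) ⨟ (mk triangle).transpose = mk triangle ⨟ mk (X 1 1 4) := by
  rw [triangle_transpose_eq, ← seq_assoc, ← seq_assoc, xphase_seq_xphase, show (4 : ZMod 8) + 4 = 0 from by decide, X_one_one, id_seq]

/-- **JPV LICS 2019, Lemma `anti-CNOT-on-controlsep`**: an anti-CNOT (green copy of the control, red `π`-merge into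
the target) in front of the transistor is a NOT behind it: `√2 ⊗ ((Z^{(1,2)} ⊗ 𝕀) ⨾ (𝕀 ⊗ X^{(2,1)}(π)) ⨾ τ) = τ ⨾ X(π)`.
[cite: JeandelPerdrixVilmart2019, Appendix (proof of `anti-CNOT-on-controlsep`); JeandelPerdrixVilmart2018, Fig. 1 (B2), (K), Appendix Lemma 21] -/
theorem antiCNOT_seq_transistor :
    mk (dumbbell 0 0) ⊠ ((mk (Z 1 2 0) ⊠ mk (wires 1)) ⨟ (mk (wires 1) ⊠ mk (X 2 1 4)) ⨟ mk transistor) = mk transistor ⨟ mk (X 1 1 4) := by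
  -- the `π` of the anti-CNOT pushed through the transistor: the triangles get transposed, a `π` lands on the output
  have hpush : (mk (wires 1) ⊠ mk (X 1 1 4)) ⨟ ((mk (X 1 2 0) ⊠ mk (wires 1)) ⨟ (mk triangle ⊠ (mk (Z 2 1 0) ⨟ (mk triangle).transpose)) ⨟ mk (Z 2 1 0)) = ((mk (X 1 2 0) ⊠ mk (wires 1)) ⨟ ((mk triangle).transpose ⊠ (mk (Z 2 1 0) ⨟ mk triangle)) ⨟ mk (Z 2 1 0)) ⨟ mk (X 1 1 4) := by
    rw [← seq_assoc, ← seq_assoc, show (mk (wires 1) ⊠ mk (X 1 1 4)) ⨟ (mk (X 1 2 0) ⊠ mk (wires 1)) = (mk (X 1 2 0) ⊠ mk (wires 1)) ⨟ (mk (wires 1) ⊠ (mk (wires 1) ⊠ mk (X 1 1 4))) from by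
        rw [interchange, id_seq, seq_id, show mk (wires 1) ⊠ (mk (wires 1) ⊠ mk (X 1 1 4)) = mk (wires 2) ⊠ mk (X 1 1 4) from by rw [← wires_par_wires 1 1]; exact (par_assoc' _ _ _).trans (cast_id _ _ _),
          interchange, seq_id, id_seq],
      seq_assoc (mk (X 1 2 0) ⊠ mk (wires 1)), show (mk (wires 1) ⊠ (mk (wires 1) ⊠ mk (X 1 1 4))) ⨟ (mk triangle ⊠ (mk (Z 2 1 0) ⨟ (mk triangle).transpose)) = mk triangle ⊠ (((mk (X 1 1 4) ⊠ mk (wires 1)) ⨟ mk (Z 2 1 0)) ⨟ (mk triangle ⨟ mk (X 1 1 4))) from by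
        rw [interchange, id_seq, ← seq_assoc, par_X_pi_seq_Z_merge, seq_assoc _ (mk (X 1 1 4)) (mk triangle).transpose, X_pi_seq_triangleT],
      show mk triangle ⊠ (((mk (X 1 1 4) ⊠ mk (wires 1)) ⨟ mk (Z 2 1 0)) ⨟ (mk triangle ⨟ mk (X 1 1 4))) = (mk (wires 1) ⊠ (mk (X 1 1 4) ⊠ mk (wires 1))) ⨟ (mk triangle ⊠ (mk (Z 2 1 0) ⨟ mk triangle)) ⨟ (mk (wires 1) ⊠ mk (X 1 1 4)) from by
        rw [interchange, id_seq, interchange, seq_id, seq_assoc, seq_assoc, seq_assoc],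
      ← seq_assoc (mk (X 1 2 0) ⊠ mk (wires 1)), ← seq_assoc (mk (X 1 2 0) ⊠ mk (wires 1)),
      show (mk (X 1 2 0) ⊠ mk (wires 1)) ⨟ (mk (wires 1) ⊠ (mk (X 1 1 4) ⊠ mk (wires 1))) = (mk (X 1 1 4) ⊠ mk (wires 1)) ⨟ (mk (X 1 2 0) ⊠ mk (wires 1)) from by
        rw [show mk (wires 1) ⊠ (mk (X 1 1 4) ⊠ mk (wires 1)) = (mk (wires 1) ⊠ mk (X 1 1 4)) ⊠ mk (wires 1) from (par_assoc' _ _ _).trans (cast_id _ _ _), ← seq_par_wires, ← seq_par_wires, X_seq_par_X 1 1 1 1 le_rfl,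
          zero_add, show mk (X 1 (1 + 1) 4) ⊠ mk (wires 1) = (mk (X 1 1 4) ⨟ mk (X 1 2 0)) ⊠ mk (wires 1) from by rw [X_seq_X 1 1 2 le_rfl, add_zero]],
      seq_assoc _ (mk (wires 1) ⊠ mk (X 1 1 4)) (mk (Z 2 1 0)), par_X_pi_seq_Z_merge, ← seq_assoc _ (((mk (X 1 1 4) ⊠ mk (wires 1)) ⨟ mk (Z 2 1 0))) (mk (X 1 1 4)), ← seq_assoc _ (mk (X 1 1 4) ⊠ mk (wires 1)) (mk (Z 2 1 0)),
      seq_assoc _ (mk triangle ⊠ (mk (Z 2 1 0) ⨟ mk triangle)) (mk (X 1 1 4) ⊠ mk (wires 1)),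
      show (mk triangle ⊠ (mk (Z 2 1 0) ⨟ mk triangle)) ⨟ (mk (X 1 1 4) ⊠ mk (wires 1)) = (mk (X 1 1 4) ⊠ mk (wires 2)) ⨟ ((mk triangle).transpose ⊠ (mk (Z 2 1 0) ⨟ mk triangle)) from by rw [interchange, seq_id, interchange, id_seq, X_pi_seq_triangleT],
      ← seq_assoc _ (mk (X 1 1 4) ⊠ mk (wires 2)),
      show ((mk (X 1 1 4) ⊠ mk (wires 1)) ⨟ (mk (X 1 2 0) ⊠ mk (wires 1))) ⨟ (mk (X 1 1 4) ⊠ mk (wires 2)) = mk (X 1 2 0) ⊠ mk (wires 1) from by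
        rw [show mk (X 1 1 4) ⊠ mk (wires 2) = (mk (X 1 1 4) ⊠ mk (wires 1)) ⊠ mk (wires 1) from by rw [← wires_par_wires 1 1]; exact (par_assoc' _ _ _).trans (cast_id _ _ _),
          ← seq_par_wires, ← seq_par_wires, seq_assoc, xsplit_seq_xphase_par, X_seq_X 1 1 2 le_rfl, show (4 : ZMod 8) + 4 = 0 from by decide]]
  -- the bialgebra `CNOT ⨾ NOTC = 1/√2 ⊗ NOTC ⨾ σ` and the symmetric merge restore the transistor
  have hcore : (mk (Z 1 2 0) ⊠ mk (wires 1)) ⨟ (mk (wires 1) ⊠ mk (X 2 1 4)) ⨟ ((mk (X 1 2 0) ⊠ mk (wires 1)) ⨟ (mk triangle ⊠ (mk (Z 2 1 0) ⨟ (mk triangle).transpose)) ⨟ mk (Z 2 1 0)) = mk invSqrtTwo ⊠ (((mk (X 1 2 0) ⊠ mk (wires 1)) ⨟ (mk triangle ⊠ (mk (Z 2 1 0) ⨟ (mk triangle).transpose)) ⨟ mk (Z 2 1 0)) ⨟ mk (X 1 1 4)) := by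
    rw [show mk (X 2 1 4) = mk (X 2 1 0) ⨟ mk (X 1 1 4) from by rw [X_seq_X 2 1 1 le_rfl, zero_add], wires_par_seq, ← seq_assoc (mk (Z 1 2 0) ⊠ mk (wires 1)), seq_assoc ((mk (Z 1 2 0) ⊠ mk (wires 1)) ⨟ (mk (wires 1) ⊠ mk (X 2 1 0))), hpush,
      ← seq_assoc ((mk (Z 1 2 0) ⊠ mk (wires 1)) ⨟ (mk (wires 1) ⊠ mk (X 2 1 0))), ← seq_assoc ((mk (Z 1 2 0) ⊠ mk (wires 1)) ⨟ (mk (wires 1) ⊠ mk (X 2 1 0))), show ((mk triangle).transpose ⊠ (mk (Z 2 1 0) ⨟ mk triangle)) = (mk (wires 1) ⊠ mk (Z 2 1 0)) ⨟ ((mk triangle).transpose ⊠ mk triangle) from by rw [eq_comm, interchange, id_seq],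
      ← seq_assoc (mk (X 1 2 0) ⊠ mk (wires 1)), ← seq_assoc ((mk (Z 1 2 0) ⊠ mk (wires 1)) ⨟ (mk (wires 1) ⊠ mk (X 2 1 0))) ((mk (X 1 2 0) ⊠ mk (wires 1)) ⨟ (mk (wires 1) ⊠ mk (Z 2 1 0))), cnot_seq_notc,
      show ∀ (s : ZXClass 0 0) (A B : ZXClass 2 2), (s ⊠ A) ⨟ B = s ⊠ (A ⨟ B) from fun s A B => by rw [scalar_par_seq_left, empty_par, cast_id],
      show ∀ (s : ZXClass 0 0) (A : ZXClass 2 2) (B : ZXClass 2 1), (s ⊠ A) ⨟ B = s ⊠ (A ⨟ B) from fun s A B => by rw [scalar_par_seq_left, empty_par, cast_id],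
      show ∀ (s : ZXClass 0 0) (A : ZXClass 2 1) (B : ZXClass 1 1), (s ⊠ A) ⨟ B = s ⊠ (A ⨟ B) from fun s A B => by rw [scalar_par_seq_left, empty_par, cast_id], seq_assoc ((mk (X 1 2 0) ⊠ mk (wires 1)) ⨟ (mk (wires 1) ⊠ mk (Z 2 1 0))) (mk swap), swap_seq_par_one_one, ← seq_assoc ((mk (X 1 2 0) ⊠ mk (wires 1)) ⨟ (mk (wires 1) ⊠ mk (Z 2 1 0))), seq_assoc _ (mk swap) (mk (Z 2 1 0)), swap_seq_Z,
      seq_assoc (mk (X 1 2 0) ⊠ mk (wires 1)) (mk (wires 1) ⊠ mk (Z 2 1 0)) (mk triangle ⊠ (mk triangle).transpose), show (mk (wires 1) ⊠ mk (Z 2 1 0)) ⨟ (mk triangle ⊠ (mk triangle).transpose) = (mk triangle ⊠ (mk (Z 2 1 0) ⨟ (mk triangle).transpose)) from by rw [interchange, id_seq]]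
  rw [mk_transistor, show ∀ (A : ZXClass 2 2) (s : ZXClass 0 0) (B : ZXClass 2 1), A ⨟ (s ⊠ B) = s ⊠ (A ⨟ B) from fun A s B => by rw [scalar_par_seq_right, empty_par, cast_id],
    hcore, show ∀ (s : ZXClass 0 0) (A : ZXClass 2 1) (B : ZXClass 1 1), (s ⊠ A) ⨟ B = s ⊠ (A ⨟ B) from fun s A B => by rw [scalar_par_seq_left, empty_par, cast_id],
    scalar_par_scalar_par (mk (dumbbell 0 0)) (mk invSqrtTwo), invSqrtTwo_par_sqrt_two_par_two_one]

end ZXClass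

end Literature.Computability.QuantumComplexity
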